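import Mathlib
import Literature.MathematicalPhysics.MHD.SolovevFluxSurfaceGGJResistive
import Literature.MathematicalPhysics.MHD.FluxSurfaceAverageCauchySchwarz
import HarnessLib

/-!
# The Cauchy–Schwarz sign of the parallel-current bracket of Jardin (8.134) IS A THEOREM on the
# Lee–Cerfon / PCF Solov'ev family: `⟨σB²/G⟩² ≤ ⟨σ²B²/(B²G)⟩·⟨B²/G⟩` for `lcGGJData`, hence GGJ's `F ≥ 0` and
# `E + H² ≤ D_R` on every surface (proved)

Twelfth file of the `lcLoop` series (gridfusion-model-5). gridfusion-lit-3's `FluxSurfaceAverageCauchySchwarz.lean`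
(p492352) proves Cauchy–Schwarz for the surface average (5.30), `GradShafranov.surfaceAverageE_div_sq_le`:
`⟨S/G⟩² ≤ ⟨S²/(PG)⟩⟨P/G⟩` for `P, G > 0` along the loop and three integrable weighted loop integrands, and
derives for a `SurfaceData` record the consequences `ggjF_nonneg`, `ggjE_add_sq_le_ggjDR`, `ggjE_neg_of_ggjDR_neg`
UNDER the input hypothesis `hCS : gσB2² ≤ gσ2B2·gB2`.  This file DISCHARGES `hCS` for the record
`lcGGJData κ F_B R₀ q₀ a g r` of every surface `0 < r < R₀/2` of `Ψ = psiLC κ F_B R₀ q₀ a` (its three averages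
ARE `⟨S/G⟩, ⟨S²/(PG)⟩, ⟨P/G⟩` with `S = gΔ*Ψ/R²`, `P = B²`, `G = |∇Ψ|²`, by definition), by proving the three
integrability hypotheses on the printed loop (each weighted integrand is an explicit continuous function of `t`:
`(1/B_p)|γ′| = w = lcAvgWeight`, `S ≡ C_s g`, `G = lcGradSq > 0`, `B² = (g² + G)/u > 0`), and records the
consequences for the volume-relabelled (Hamada) pieces used by the resistive index (`SolovevFluxSurfaceGGJResistive.lean`).
HONEST FRAMING: exact real analysis about MODEL objects; no enclosure, no stability claim.
Typer/prover: gridfusion-model-5 (g4), 2026-08-27.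
-/

noncomputable section

namespace Literature.MathematicalPhysics.MHD.Solovev

open GradShafranov FluxGeometry Mercier.FluxForm _root_.Real MeasureTheory intervalIntegral _root_.Set

section cs

variable {R₀ κ FB q₀ r : ℝ} (hR₀ : 0 < R₀) (hκ : 0 < κ) (hFB : 0 < FB) (hq₀ : 0 < q₀)
  (hr : 0 < r) (h2r : 2 * r < R₀)
include hR₀ hκ hFB hq₀ hr h2r

/-- Continuity in `t` of `u`, `G = lcGradSq`, `w = lcAvgWeight` on a surface (`u, G > 0`). [folklore] -/
private theorem cs_continuous_blocks :
    Continuous (fun t => lcU R₀ r t) ∧ Continuous (fun t => lcGradSq κ FB R₀ q₀ r t)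
      ∧ Continuous (fun t => lcAvgWeight κ FB R₀ q₀ r t) := by
  have hcU : Continuous (fun t => lcU R₀ r t) := by unfold lcU; fun_prop
  have hpos : ∀ t, 0 < lcU R₀ r t := lcU_pos hR₀ hr.le h2r
  refine ⟨hcU, ?_, continuous_lcAvgWeight hR₀ hκ hFB hq₀ hr.le h2r⟩
  rw [continuous_iff_continuousAt]
  intro t
  have hu := hpos t
  unfold lcGradSq
  fun_prop (disch := positivity)

/-- The weighted loop integrand of `⟨σB²/G⟩` is the continuous function `C_s g / G · w`; in particular it is
integrable on `[0, 2π]`. [cite: Jardin2010, §5.3 eq. (5.30)] -/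
theorem intervalIntegrable_sigmaBsq_div_gradSq (a g : ℝ) :
    IntervalIntegrable (fun t =>
      (g * gsOperator (psiLC κ FB R₀ q₀ a) (lcLoop R₀ κ r t).1 (lcLoop R₀ κ r t).2 / (lcLoop R₀ κ r t).1 ^ 2)
        / gradSq (psiLC κ FB R₀ q₀ a) (lcLoop R₀ κ r t).1 (lcLoop R₀ κ r t).2
        / fieldBpol (psiLC κ FB R₀ q₀ a) (lcLoop R₀ κ r t).1 (lcLoop R₀ κ r t).2 * speed (lcLoop R₀ κ r) t)
      volume 0 (2 * π) := by
  obtain ⟨hcU, hcG, hcW⟩ := cs_continuous_blocks hR₀ hκ hFB hq₀ hr h2r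
  have hposG : ∀ t, 0 < lcGradSq κ FB R₀ q₀ r t := lcGradSq_pos hR₀ hκ hFB hq₀ hr h2r
  have e : (fun t =>
      (g * gsOperator (psiLC κ FB R₀ q₀ a) (lcLoop R₀ κ r t).1 (lcLoop R₀ κ r t).2 / (lcLoop R₀ κ r t).1 ^ 2)
        / gradSq (psiLC κ FB R₀ q₀ a) (lcLoop R₀ κ r t).1 (lcLoop R₀ κ r t).2
        / fieldBpol (psiLC κ FB R₀ q₀ a) (lcLoop R₀ κ r t).1 (lcLoop R₀ κ r t).2 * speed (lcLoop R₀ κ r) t)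
      = fun t => csLC κ FB R₀ q₀ * g / lcGradSq κ FB R₀ q₀ r t * lcAvgWeight κ FB R₀ q₀ r t := by
    funext t
    rw [div_eq_mul_one_div _ (fieldBpol _ _ _), mul_assoc, lcLoop_volumeIntegrand hR₀ hκ hFB hq₀ hr h2r a t,
      sigmaBsq_lcLoop hR₀ hκ hq₀ hr h2r a g t, gradSq_psiLC_lcLoop hR₀ hκ.ne' hr.le h2r]
    rfl
  rw [e]
  exact ((continuous_const.div hcG fun t => (hposG t).ne').mul hcW).intervalIntegrable _ _

/-- The weighted loop integrand of `⟨σ²B²/(B²G)⟩` is the continuous function `(C_s g)²·u/((g²+G)G) · w`;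
integrable on `[0, 2π]`. [cite: Jardin2010, §5.3 eq. (5.30)] -/
theorem intervalIntegrable_sigmaSqBsq_div (a g : ℝ) :
    IntervalIntegrable (fun t =>
      (g * gsOperator (psiLC κ FB R₀ q₀ a) (lcLoop R₀ κ r t).1 (lcLoop R₀ κ r t).2 / (lcLoop R₀ κ r t).1 ^ 2) ^ 2
        / (fieldBsq (fun _ => g) (psiLC κ FB R₀ q₀ a) (lcLoop R₀ κ r t).1 (lcLoop R₀ κ r t).2
          * gradSq (psiLC κ FB R₀ q₀ a) (lcLoop R₀ κ r t).1 (lcLoop R₀ κ r t).2)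
        / fieldBpol (psiLC κ FB R₀ q₀ a) (lcLoop R₀ κ r t).1 (lcLoop R₀ κ r t).2 * speed (lcLoop R₀ κ r) t)
      volume 0 (2 * π) := by
  obtain ⟨hcU, hcG, hcW⟩ := cs_continuous_blocks hR₀ hκ hFB hq₀ hr h2r
  have hposU : ∀ t, 0 < lcU R₀ r t := lcU_pos hR₀ hr.le h2r
  have hposG : ∀ t, 0 < lcGradSq κ FB R₀ q₀ r t := lcGradSq_pos hR₀ hκ hFB hq₀ hr h2r
  have e : (fun t =>
      (g * gsOperator (psiLC κ FB R₀ q₀ a) (lcLoop R₀ κ r t).1 (lcLoop R₀ κ r t).2 / (lcLoop R₀ κ r t).1 ^ 2) ^ 2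
        / (fieldBsq (fun _ => g) (psiLC κ FB R₀ q₀ a) (lcLoop R₀ κ r t).1 (lcLoop R₀ κ r t).2
          * gradSq (psiLC κ FB R₀ q₀ a) (lcLoop R₀ κ r t).1 (lcLoop R₀ κ r t).2)
        / fieldBpol (psiLC κ FB R₀ q₀ a) (lcLoop R₀ κ r t).1 (lcLoop R₀ κ r t).2 * speed (lcLoop R₀ κ r) t)
      = fun t => (csLC κ FB R₀ q₀ * g) ^ 2
          / ((g ^ 2 + lcGradSq κ FB R₀ q₀ r t) / lcU R₀ r t * lcGradSq κ FB R₀ q₀ r t)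
          * lcAvgWeight κ FB R₀ q₀ r t := by
    funext t
    rw [div_eq_mul_one_div _ (fieldBpol _ _ _), mul_assoc, lcLoop_volumeIntegrand hR₀ hκ hFB hq₀ hr h2r a t,
      sigmaBsq_lcLoop hR₀ hκ hq₀ hr h2r a g t, fieldBsq_lcLoop hR₀ hκ.ne' hr.le h2r,
      gradSq_psiLC_lcLoop hR₀ hκ.ne' hr.le h2r]
    rfl
  rw [e]
  refine ((continuous_const.div (((continuous_const.add hcG).div hcU fun t => (hposU t).ne').mul hcG)
    fun t => ?_).mul hcW).intervalIntegrable _ _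
  have hu := hposU t
  have hG := hposG t
  have h1 : 0 < g ^ 2 + lcGradSq κ FB R₀ q₀ r t := by positivity
  exact (mul_pos (div_pos h1 hu) hG).ne'

/-- The weighted loop integrand of `⟨B²/G⟩` is the continuous function `(g²+G)/(uG) · w`; integrable on
`[0, 2π]`. [cite: Jardin2010, §5.3 eq. (5.30)] -/
theorem intervalIntegrable_bsq_div_gradSq (a g : ℝ) :
    IntervalIntegrable (fun t =>
      fieldBsq (fun _ => g) (psiLC κ FB R₀ q₀ a) (lcLoop R₀ κ r t).1 (lcLoop R₀ κ r t).2
        / gradSq (psiLC κ FB R₀ q₀ a) (lcLoop R₀ κ r t).1 (lcLoop R₀ κ r t).2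
        / fieldBpol (psiLC κ FB R₀ q₀ a) (lcLoop R₀ κ r t).1 (lcLoop R₀ κ r t).2 * speed (lcLoop R₀ κ r) t)
      volume 0 (2 * π) := by
  obtain ⟨hcU, hcG, hcW⟩ := cs_continuous_blocks hR₀ hκ hFB hq₀ hr h2r
  have hposU : ∀ t, 0 < lcU R₀ r t := lcU_pos hR₀ hr.le h2r
  have hposG : ∀ t, 0 < lcGradSq κ FB R₀ q₀ r t := lcGradSq_pos hR₀ hκ hFB hq₀ hr h2r
  have e : (fun t =>
      fieldBsq (fun _ => g) (psiLC κ FB R₀ q₀ a) (lcLoop R₀ κ r t).1 (lcLoop R₀ κ r t).2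
        / gradSq (psiLC κ FB R₀ q₀ a) (lcLoop R₀ κ r t).1 (lcLoop R₀ κ r t).2
        / fieldBpol (psiLC κ FB R₀ q₀ a) (lcLoop R₀ κ r t).1 (lcLoop R₀ κ r t).2 * speed (lcLoop R₀ κ r) t)
      = fun t => (g ^ 2 + lcGradSq κ FB R₀ q₀ r t) / lcU R₀ r t / lcGradSq κ FB R₀ q₀ r t
          * lcAvgWeight κ FB R₀ q₀ r t := by
    funext t
    rw [div_eq_mul_one_div _ (fieldBpol _ _ _), mul_assoc, lcLoop_volumeIntegrand hR₀ hκ hFB hq₀ hr h2r a t,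
      fieldBsq_lcLoop hR₀ hκ.ne' hr.le h2r, gradSq_psiLC_lcLoop hR₀ hκ.ne' hr.le h2r]
    rfl
  rw [e]
  exact (((((continuous_const.add hcG).div hcU fun t => (hposU t).ne').div hcG)
    fun t => (hposG t).ne').mul hcW).intervalIntegrable _ _

/-- **Cauchy–Schwarz for the parallel-current bracket on the family (lit-3's `hCS`, discharged):**
`⟨σB²/|∇Ψ|²⟩² ≤ ⟨σ²B²/(B²|∇Ψ|²)⟩·⟨B²/|∇Ψ|²⟩` for `lcGGJData κ F_B R₀ q₀ a g r` on every surface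
`0 < r < R₀/2`, every free constant `g`. [cite: Jardin2010, §8.5.4 eq. (8.134)] -/
theorem lcGGJData_cauchySchwarz (a g : ℝ) :
    (lcGGJData κ FB R₀ q₀ a g r).gσB2 ^ 2
      ≤ (lcGGJData κ FB R₀ q₀ a g r).gσ2B2 * (lcGGJData κ FB R₀ q₀ a g r).gB2 := by
  have hposU : ∀ t, 0 < lcU R₀ r t := lcU_pos hR₀ hr.le h2r
  have hposG : ∀ t, 0 < lcGradSq κ FB R₀ q₀ r t := lcGradSq_pos hR₀ hκ hFB hq₀ hr h2r
  show surfaceAverageE _ _ _ _ ^ 2 ≤ surfaceAverageE _ _ _ _ * surfaceAverageE _ _ _ _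
  exact surfaceAverageE_div_sq_le (by positivity)
    (S := fun R Z => g * gsOperator (psiLC κ FB R₀ q₀ a) R Z / R ^ 2)
    (P := fun R Z => fieldBsq (fun _ => g) (psiLC κ FB R₀ q₀ a) R Z)
    (G := fun R Z => gradSq (psiLC κ FB R₀ q₀ a) R Z)
    (fun t _ => by
      rw [fieldBsq_lcLoop hR₀ hκ.ne' hr.le h2r]
      have hu := hposU t
      have hG := hposG t
      positivity)
    (fun t _ => by rw [gradSq_psiLC_lcLoop hR₀ hκ.ne' hr.le h2r]; exact hposG t)
    (intervalIntegrable_sigmaBsq_div_gradSq hR₀ hκ hFB hq₀ hr h2r a g)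
    (intervalIntegrable_sigmaSqBsq_div hR₀ hκ hFB hq₀ hr h2r a g)
    (intervalIntegrable_bsq_div_gradSq hR₀ hκ hFB hq₀ hr h2r a g)

/-- Hence GGJ's `F ≥ 0` for the volume-relabelled (Hamada) record of every surface (lit-3's `ggjF_nonneg`
with its `hCS` discharged; `⟨B²/G⟩ > 0` by `lcGGJData_gB2_pos`, `⟨1/B²⟩ ≥ 0` by positivity of its integral).
[cite: Zheng2015, §2.3 eq. (2.64)] -/
theorem ggjF_relabel_volume_nonneg (a g : ℝ) :
    0 ≤ ((lcGGJData κ FB R₀ q₀ a g r).relabel (lcGGJData κ FB R₀ q₀ a g r).V'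
        (lcGGJData κ FB R₀ q₀ a g r).V'').ggjF := by
  set d := lcGGJData κ FB R₀ q₀ a g r with hd
  have hV : d.V' ≠ 0 := lcGGJData_V'_ne hR₀ hκ hFB hq₀ hr h2r (a := a) (g := g)
  have hg : 0 < d.gB2 := lcGGJData_gB2_pos hR₀ hκ hFB hq₀ hr h2r a g
  have hCS : d.gσB2 ^ 2 ≤ d.gσ2B2 * d.gB2 := lcGGJData_cauchySchwarz hR₀ hκ hFB hq₀ hr h2r a g
  have hinv : 0 ≤ d.invB2 := by
    rw [hd, lcGGJData_invB2 hR₀ hκ hFB hq₀ hr h2r]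
    obtain ⟨-, -, -, h4, -⟩ := integral_ggjBlocks_pos hR₀ hκ hFB hq₀ hr h2r g
    exact div_nonneg h4.le (integral_lcAvgWeight_pos hR₀ hκ hFB hq₀ hr.le h2r).le
  refine (d.relabel d.V' d.V'').ggjF_nonneg ?_ ?_ ?_
  · simp only [SurfaceData.relabel]
    have : (d.gσB2 / d.V' ^ 2) ^ 2 = d.gσB2 ^ 2 / (d.V' ^ 2) ^ 2 := by ring
    rw [this, div_mul_div_comm, ← sq]
    exact div_le_div_of_nonneg_right hCS (by positivity)
  · simp only [SurfaceData.relabel]; positivity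
  · simp only [SurfaceData.relabel]; exact hinv

/-- And `E + H² ≤ D_R` on every surface: a certified `D_R < 0` forces `E < 0` there (lit-3's
`ggjE_neg_of_ggjDR_neg`, `hCS` discharged). [cite: Zheng2015, §3.2 eq. (3.42)] -/
theorem ggjE_neg_of_lcResistiveIndex_neg (a g : ℝ) (h : lcResistiveIndex κ FB R₀ q₀ a g r < 0) :
    ((lcGGJData κ FB R₀ q₀ a g r).relabel (lcGGJData κ FB R₀ q₀ a g r).V'
        (lcGGJData κ FB R₀ q₀ a g r).V'').ggjE (csLC κ FB R₀ q₀ * g)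
      (surfaceAverageE (psiLC κ FB R₀ q₀ a) (lcLoop R₀ κ r) (2 * π)
        (fun R Z => fieldBsq (fun _ => g) (psiLC κ FB R₀ q₀ a) R Z)) < 0 := by
  set d := lcGGJData κ FB R₀ q₀ a g r with hd
  have hV : d.V' ≠ 0 := lcGGJData_V'_ne hR₀ hκ hFB hq₀ hr h2r (a := a) (g := g)
  have hg : 0 < d.gB2 := lcGGJData_gB2_pos hR₀ hκ hFB hq₀ hr h2r a g
  have hCS : d.gσB2 ^ 2 ≤ d.gσ2B2 * d.gB2 := lcGGJData_cauchySchwarz hR₀ hκ hFB hq₀ hr h2r a g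
  have hinv : 0 ≤ d.invB2 := by
    rw [hd, lcGGJData_invB2 hR₀ hκ hFB hq₀ hr h2r]
    obtain ⟨-, -, -, h4, -⟩ := integral_ggjBlocks_pos hR₀ hκ hFB hq₀ hr h2r g
    exact div_nonneg h4.le (integral_lcAvgWeight_pos hR₀ hκ hFB hq₀ hr.le h2r).le
  have h' : (d.relabel d.V' d.V'').ggjDR (csLC κ FB R₀ q₀ * g)
      (surfaceAverageE (psiLC κ FB R₀ q₀ a) (lcLoop R₀ κ r) (2 * π)
        (fun R Z => fieldBsq (fun _ => g) (psiLC κ FB R₀ q₀ a) R Z)) < 0 := by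
    unfold lcResistiveIndex at h
    rw [surfaceAverageE_lcLoop_sigmaBsq hR₀ hκ hq₀ hr h2r hFB] at h
    exact h
  refine (d.relabel d.V' d.V'').ggjE_neg_of_ggjDR_neg _ _ ?_ ?_ ?_ h'
  · simp only [SurfaceData.relabel]
    have : (d.gσB2 / d.V' ^ 2) ^ 2 = d.gσB2 ^ 2 / (d.V' ^ 2) ^ 2 := by ring
    rw [this, div_mul_div_comm, ← sq]
    exact div_le_div_of_nonneg_right hCS (by positivity)
  · simp only [SurfaceData.relabel]; positivity
  · simp only [SurfaceData.relabel]; exact hinv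

end cs

end Literature.MathematicalPhysics.MHD.Solovev
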